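import Summits.Schanuel.Schanuel.Theorems.RootDecomp1KCollarCell01

/-!
# RootDecomp1KCollarCell — lens 1, generation 48, node 7 «THE COLLAR CELL: skeleton-RESONANT dyadic approximants are never level points (2-adic interlacing, all P, m-free), with a certified member of EXACT Skel-order m» (CLAIM L2417, EX-ANTE PRICE + CHECKLIST K-g48 L2418, NODE L2431 / REQUEST L2432; critic VERDICT L2435: CLEARED AS PRICED — ONE CELL ×1 «DYADIC COLLAR», RULE K-R37, PORT GO) — continuation (RootDecomp1KCollarCell02): §2 the class DyadicCollarLiouville and its engine (T2–T4)

(lens-1 g48 HOME kernel K = HOME/decomp-schanuel-lens-1/g48/CollarCell.lean f82e9183…, 1281 l, imports …RootDecomp1KDegreeLadder05 + …RootDecomp1KDarkLogSq04 BY NAME; P CollarCellProbe.lean 50792f78… rc 0 / C CollarCellCtrl.lean 9aabc182… rc 1 = 14 planted; memo NODE-g48.md; NODE L2431 / REQUEST L2432. Port by census-1 gen 21 as `RootDecomp1KCollarCell01–06` along K's §1–§5 with §3 cut in two by the 400-line file cap: 01 = §1 (T1) the 2-adic interlacing lemma `twoAdic_bev_ne_zero` with `maxval₂`, `weights_injective`;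 02 = §2 the class `DyadicCollarLiouville` («[class] definition» tag) and its engine `bev_ne_zero_of_collar` (T2), `algebraicIndependent_ell2_of_collar` (T3), `statement_b_on_collar_ge_one`, `not_dyadicCollarLiouville_uStar`, `sb_collarPair` / `coordLiouvilleSchanuel_collarPair` (T4, item 31077's binders verbatim at n = 2, whole class, hyp-free); 03 = §3a the run pattern `Nn`/`fN`/`gN`, increments `aN`, `rhoNat`, tails `tailN`; 04 = §3b numerators `MN`, truncations `tN`, overshoots `uN`/`UN`, `iota_two_pow_fN`, `rhoNat_ne_tN`; 05 = §4 certificates M1 `dyadicCollarLiouville_rhoNat`, M2 `skelLiouvilleFix_rhoNat`, cover `rhoNat_cover`, M3 `not_skelLiouvilleFix_succ_rhoNat` / `not_skelLiouville_rhoNat`, M4 `not_factorialGapLiouville_rhoNat`, M5 `not_logLogLiouville_rhoNat` + `not_logSqLiouville_rhoNat` / `not_logHyperLiouville_rhoNat` / `not_hyperLiouville_rhoNat` / `not_liouvilleOrder_rhoNat`, `liouville_rhoNat`, `dyadicCollarLiouville_not_subset`; 06 = §5 the exhibited tuple `zN2 = (ℓ₂, ρ♮₂)`: `linearIndependent_zN2`,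 `coordLiouvilleSpan_zN2`, `zN2_in_scope_31077`, `sb_zN2`, `coordLiouvilleSchanuel_at_zN2`, `item31077_at_zN2`, `rhoNat_two_profile` — ALL HYP-FREE. PORT EDITS (census convention, as sanctioned for every K-line port): `set_option linter.dupNamespace false` dropped; «[class] definition (membership predicate with parameters, NOT a fact; census convention)» wording on `DyadicCollarLiouville`; 35 one-line helper docstrings added; K's `liouvilleNumber_two_lt` (§2) DELETED in favour of the byte-identical tree decl `RootDecomp1KRelLiouvilleCell.liouvilleNumber_two_lt` (RelLiouvilleCell03, already in the import cone; dedup bounce p838600) — referenced via the §2 `open … (… liouvilleNumber_two_lt)` list; two generic §1 one-liners privatised; per-part private helper copies if any; statements and proofs otherwise verbatim (no renames). `--supports stmt-Schanuel-31077`; no census credit carried; rung 0 — nothing here proves Schanuel; no ∀-item moves; 31077 and 33364 stay OPEN.)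
-/

noncomputable section

open Polynomial LiouvilleNumber
open scoped Nat

namespace Summit.Schanuel.Schanuel.Theorems.RootDecomp1KCollarCell

open Summit.Schanuel.Schanuel.Theorems.RootDecomp1KDegreeLadder
  (bev bev_eq_double_sum xdeg natDegree_coeff_le_xdeg specX aeval_specX natDegree_specX_le
   abs_aeval_ge_of_ne_zero lipschitz_x lipschitz_y algebraicIndependent_of_no_relation)
open Summit.Schanuel.Schanuel.Theorems.RootDecomp1KSkelCell
  (iota iota_spec iota_le_of_le pow_lt_of_lt_iota lt_iota_of_pow_lt iota_mono one_le_iota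
   SkelLiouville SkelLiouvilleFix skelLiouville_iff_fix SkelLiouvilleFix.mono logLogLiouville_skelLiouville)
open Summit.Schanuel.Schanuel.Theorems.RootDecomp1KLogLogCell
  (LogLogLiouville logLogLiouville_of_logSqLiouville logLogLiouville_of_logHyperLiouville
   logLogLiouville_of_hyperLiouville)
open Summit.Schanuel.Schanuel.Theorems.RootDecomp1KGeneric (LogSqLiouville LiouvilleOrder)
open Summit.Schanuel.Schanuel.Theorems.RootDecomp1KRelLiouvilleCell (LogHyperLiouville)
open Summit.Schanuel.Schanuel.Theorems.RootDecomp1KDarkLogSq (logHyperLiouville_of_liouvilleOrder)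
open Summit.Schanuel.Schanuel.Theorems.RootDecomp1KTwoBaseCell
  (psNumer partialSum_eq_psNumer_div coprime_psNumer sb_of_range_eq')
open Summit.Schanuel.Schanuel.Theorems.RootDecomp1KGapCell (FactorialGapLiouville)
open Summit.Schanuel.Schanuel.Theorems.RootDecomp1KHyper
open Summit.Schanuel.Schanuel.Theorems.RootDecomp1KHyper.HyperCell

/-! ## §2  THE CLASS `DyadicCollarLiouville` AND ITS ENGINE (T2–T4) -/
section Engine

open Summit.Schanuel.Schanuel.Theorems.RootDecomp1KRelLiouvilleCell
  (partialSum_two_strictMono partialSum_two_lt_liouvilleNumber partialSum_two_pos liouvilleNumber_two_pos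
   abs_liouvilleNumber_two_sub_partialSum partialSum_two_zero liouvilleNumber_two_lt)

/-- [class] definition (membership predicate with parameters, NOT a fact; census convention): **`DyadicCollarLiouville`.**  `ρ` has, for every quality `A` and beyond every `K`,
a dyadic approximant `t` with `|ρ − t| < den(t)^{−A}` whose denominator `2^{N!+h}`, `A ≤ h ≤ N!/A`, sits in
the COLLAR `(2^{N!+A}, 2^{N!(1+1/A)}]` of the skeleton point `2^{N!}` of `ℓ₂ = Σ 2^{−n!}` — the RESONANT
heights `h(t) ≈ h(s_N)`, complementary to the gap-located class `FactorialGapLiouville` (denominators in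
`(2^{A·N!}, 2^{(N+1)!/A})`) and to the skeleton points themselves (`h = 0`).  Order and location data only. -/
def DyadicCollarLiouville (ρ : ℝ) : Prop :=
  ∀ A K : ℕ, ∃ N : ℕ, K ≤ N ∧ ∃ h : ℕ, A ≤ h ∧ A * h ≤ N ! ∧
    ∃ t : ℚ, t.den = 2 ^ (N ! + h) ∧ |ρ - t| < 1 / (t.den : ℝ) ^ A

/-- `p_N = 2^{N!} s_N` is odd (as an integer). -/
theorem odd_psNumer_two {N : ℕ} (hN : 2 ≤ N) : Odd ((psNumer 2 N : ℕ) : ℤ) := by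
  have hc := coprime_psNumer 2 hN
  have hnd : ¬ 2 ∣ psNumer 2 N := fun hdvd => by
    have := Nat.Coprime.eq_one_of_dvd hc.symm hdvd
    omega
  have hodd : Odd (psNumer 2 N) := Nat.odd_iff.mpr (Nat.two_dvd_ne_zero.mp hnd)
  obtain ⟨k, hk⟩ := hodd
  exact ⟨k, by rw [hk]; push_cast; ring⟩

/-- The numerator of a rational with denominator `2^E`, `E ≠ 0`, is odd. -/
theorem odd_num_of_den_two_pow {t : ℚ} {E : ℕ} (hE : E ≠ 0) (ht : t.den = 2 ^ E) : Odd t.num := by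
  have hcop : t.num.natAbs.Coprime t.den := t.reduced
  rw [ht] at hcop
  have hnd : ¬ 2 ∣ t.num.natAbs := fun hdvd => by
    have h2 : Nat.Coprime 2 (2 ^ E) := Nat.Coprime.coprime_dvd_left hdvd hcop
    have := Nat.Coprime.eq_one_of_dvd h2 (dvd_pow_self 2 hE)
    omega
  have hodd : Odd t.num.natAbs := Nat.odd_iff.mpr (Nat.two_dvd_ne_zero.mp hnd)
  exact Int.natAbs_odd.mp hodd

/-- The closing arithmetic of the engine (pure bookkeeping in powers of `2`). -/
theorem collar_final_ineq {a d V N h K₀ : ℕ} {C₂ C₆ : ℝ} (hC₂ : 0 < C₂) (hC₆ : 0 < C₆)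
    (hK : 4 * C₆ + 2 * C₂ < (2 : ℝ) ^ K₀) (hN1 : a + 2 * d + 1 ≤ N) (hN2 : K₀ ≤ N) (hh : h ≤ N !) :
    (2 : ℝ) ^ ((N ! + h) * d) * (C₆ * (2 / (2 : ℝ) ^ (N + 1)!) +
        C₂ * (1 / (2 : ℝ) ^ ((N ! + h) * (a + d + V + 2)))) < 1 / (2 : ℝ) ^ (N ! * a) := by
  have hNf : N ≤ N ! := Nat.self_le_factorial N
  have hK0 : (2 : ℝ) ^ K₀ ≤ (2 : ℝ) ^ N ! := pow_le_pow_right₀ (by norm_num) (hN2.trans hNf)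
  have h4C₆ : 4 * C₆ < (2 : ℝ) ^ N ! := by linarith
  have h2C₂ : 2 * C₂ < (2 : ℝ) ^ N ! := by linarith
  -- exponent bookkeeping
  have hdh : d * h ≤ d * N ! := Nat.mul_le_mul_left d hh
  have e1 : N ! + ((N ! + h) * d + N ! * a) ≤ (N + 1)! := by
    rw [Nat.factorial_succ]
    have : (a + 2 * d + 1 + 1) * N ! ≤ (N + 1) * N ! := Nat.mul_le_mul_right _ (by omega)
    nlinarith
  have e2 : N ! + ((N ! + h) * d + N ! * a) ≤ (N ! + h) * (a + d + V + 2) := by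
    have hx : N ! * a ≤ (N ! + h) * a := Nat.mul_le_mul_right a (Nat.le_add_right _ _)
    nlinarith
  have key1 : 4 * C₆ * ((2 : ℝ) ^ ((N ! + h) * d) * (2 : ℝ) ^ (N ! * a)) < (2 : ℝ) ^ (N + 1)! := by
    calc 4 * C₆ * ((2 : ℝ) ^ ((N ! + h) * d) * (2 : ℝ) ^ (N ! * a))
        < (2 : ℝ) ^ N ! * ((2 : ℝ) ^ ((N ! + h) * d) * (2 : ℝ) ^ (N ! * a)) :=
          mul_lt_mul_of_pos_right h4C₆ (by positivity)
      _ = (2 : ℝ) ^ (N ! + ((N ! + h) * d + N ! * a)) := by rw [pow_add, pow_add]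
      _ ≤ (2 : ℝ) ^ (N + 1)! := pow_le_pow_right₀ (by norm_num) e1
  have key2 : 2 * C₂ * ((2 : ℝ) ^ ((N ! + h) * d) * (2 : ℝ) ^ (N ! * a)) <
      (2 : ℝ) ^ ((N ! + h) * (a + d + V + 2)) := by
    calc 2 * C₂ * ((2 : ℝ) ^ ((N ! + h) * d) * (2 : ℝ) ^ (N ! * a))
        < (2 : ℝ) ^ N ! * ((2 : ℝ) ^ ((N ! + h) * d) * (2 : ℝ) ^ (N ! * a)) :=
          mul_lt_mul_of_pos_right h2C₂ (by positivity)
      _ = (2 : ℝ) ^ (N ! + ((N ! + h) * d + N ! * a)) := by rw [pow_add, pow_add]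
      _ ≤ (2 : ℝ) ^ ((N ! + h) * (a + d + V + 2)) := pow_le_pow_right₀ (by norm_num) e2
  have hX : (0 : ℝ) < (2 : ℝ) ^ (N ! * a) := by positivity
  have hT1 : (2 : ℝ) ^ ((N ! + h) * d) * (C₆ * (2 / (2 : ℝ) ^ (N + 1)!)) < 1 / (2 * (2 : ℝ) ^ (N ! * a)) := by
    rw [show (2 : ℝ) ^ ((N ! + h) * d) * (C₆ * (2 / (2 : ℝ) ^ (N + 1)!)) =
      (2 * C₆ * (2 : ℝ) ^ ((N ! + h) * d)) / (2 : ℝ) ^ (N + 1)! by ring]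
    rw [div_lt_div_iff₀ (by positivity) (by positivity)]
    nlinarith [key1]
  have hT2 : (2 : ℝ) ^ ((N ! + h) * d) * (C₂ * (1 / (2 : ℝ) ^ ((N ! + h) * (a + d + V + 2)))) <
      1 / (2 * (2 : ℝ) ^ (N ! * a)) := by
    rw [show (2 : ℝ) ^ ((N ! + h) * d) * (C₂ * (1 / (2 : ℝ) ^ ((N ! + h) * (a + d + V + 2)))) =
      (C₂ * (2 : ℝ) ^ ((N ! + h) * d)) / (2 : ℝ) ^ ((N ! + h) * (a + d + V + 2)) by ring]
    rw [div_lt_div_iff₀ (by positivity) (by positivity)]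
    nlinarith [key2]
  have hsum : 1 / (2 * (2 : ℝ) ^ (N ! * a)) + 1 / (2 * (2 : ℝ) ^ (N ! * a)) = 1 / (2 : ℝ) ^ (N ! * a) := by
    field_simp; ring
  rw [mul_add, ← hsum]
  exact add_lt_add hT1 hT2

/-- **(T2) THE COLLAR ENGINE.**  For `ρ ∈ DyadicCollarLiouville` and every non-zero `P ∈ ℤ[x][Y]`:
`P(ℓ₂, ρ) ≠ 0`.  SIMULTANEOUS specialisation at MATCHED heights: at the collar approximant `t = M/2^{N!+h}` of
quality `A := xdeg P + deg_Y P + maxval₂ P + 2` and the skeleton truncation `s_N = p_N/2^{N!}` of `ℓ₂`, (T1)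
gives `P(s_N, t) ≠ 0`, integrality (tree `aeval_specX` / `abs_aeval_ge_of_ne_zero` BY NAME) gives
`|P(s_N, t)| ≥ 2^{−(xdeg·N! + deg·(N!+h))}`, while the tree's Lipschitz bounds (`lipschitz_x` / `lipschitz_y`
BY NAME) give `|P(s_N, t) − P(ℓ₂, ρ)| ≤ C₆·2^{1−(N+1)!} + C₂·den(t)^{−A}` — smaller, because `h ≤ N!/A` keeps
`den(t)^{deg}` far below `2^{(N+1)!}` and `A > xdeg + deg` beats the integrality loss.  No measure, no gap, no
lacunarity, no threshold on `P`. -/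
theorem bev_ne_zero_of_collar {ρ : ℝ} (hρ : DyadicCollarLiouville ρ) (P : ℤ[X][X]) (hP : P ≠ 0) :
    bev P (liouvilleNumber 2) ρ ≠ 0 := by
  classical
  intro h0
  obtain ⟨C₂, hC₂, hLy⟩ := lipschitz_y P (liouvilleNumber 2) ρ
  obtain ⟨C₆, hC₆, hLx⟩ := lipschitz_x P ρ
  obtain ⟨K₀, hK₀⟩ := pow_unbounded_of_one_lt (4 * C₆ + 2 * C₂) (by norm_num : (1 : ℝ) < 2)
  set a := xdeg P with ha
  set d := P.natDegree with hd
  set V := maxval₂ P with hV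
  obtain ⟨N, hKN, h, hAh, hAhN, t, htden, hlt⟩ := hρ (a + d + V + 2) (max (a + 2 * d + 2) K₀)
  have hN1 : a + 2 * d + 2 ≤ N := (le_max_left _ _).trans hKN
  have hN2 : K₀ ≤ N := (le_max_right _ _).trans hKN
  have h2N : 2 ≤ N := by omega
  have hh1 : 1 ≤ h := le_trans (by omega : 1 ≤ a + d + V + 2) hAh
  have hhN : h ≤ N ! := le_trans (Nat.le_mul_of_pos_left h (by omega : 0 < a + d + V + 2)) hAhN
  set E := N ! + h with hE
  have hE0 : E ≠ 0 := by omega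
  -- the two specialisation points as dyadic fractions
  have hsN : partialSum 2 N = (((psNumer 2 N : ℕ) : ℤ) : ℝ) / 2 ^ N ! := by
    rw [Int.cast_natCast]
    have := partialSum_eq_psNumer_div (b := 2) two_pos N
    simpa using this
  have hdenR : (t.den : ℝ) = (2 : ℝ) ^ E := by rw [htden]; push_cast; rfl
  have htR : (t : ℝ) = (t.num : ℝ) / 2 ^ (N ! + h) := by rw [Rat.cast_def, hdenR]
  -- (T1) at (s_N, t)
  have hT1 : bev P (partialSum 2 N) t ≠ 0 := by
    rw [hsN, htR]
    refine twoAdic_bev_ne_zero P hP (odd_psNumer_two h2N) (odd_num_of_den_two_pow hE0 htden) ?_ ?_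
    · rw [← hV]; omega
    · rw [← hd, ← hV]
      have e : (a + d + V + 2) * h = d * h + (a + V + 2) * h := by ring
      have : V + 2 ≤ (a + V + 2) * h := le_trans (by omega) (Nat.le_mul_of_pos_right _ hh1)
      omega
  -- integrality: |P(s_N, t)| ≥ 2^{−(a·N! + d·E)}
  have hD : 0 < 2 ^ N ! := by positivity
  have hDcast : (((2 ^ N ! : ℕ) : ℝ)) = (2 : ℝ) ^ N ! := by push_cast; rfl
  have hne : aeval ((((psNumer 2 N : ℕ) : ℤ) : ℝ) / ((2 ^ N ! : ℕ) : ℝ)) (specX P t) ≠ 0 := by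
    rw [hDcast, ← hsN, aeval_specX]
    exact mul_ne_zero (pow_ne_zero _ (by rw [hdenR]; positivity)) hT1
  have hint := abs_aeval_ge_of_ne_zero (specX P t) ((psNumer 2 N : ℕ) : ℤ) hD (natDegree_specX_le P t) hne
  rw [hDcast, ← hsN, aeval_specX, abs_mul, hdenR, abs_of_pos (by positivity : (0 : ℝ) < ((2 : ℝ) ^ E) ^ d),
    ← pow_mul, ← pow_mul] at hint
  -- hint : 1 / 2 ^ (N ! * a) ≤ 2 ^ (E * d) * |bev P (partialSum 2 N) ↑t|
  -- Lipschitz: |P(s_N, t)| = |P(s_N, t) − P(ℓ₂, ρ)| ≤ C₆ |s_N − ℓ₂| + C₂ |t − ρ|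
  have htρ : |(t : ℝ) - ρ| ≤ 1 := by
    rw [abs_sub_comm]
    refine hlt.le.trans ?_
    rw [div_le_one (by positivity)]
    exact one_le_pow₀ (by rw [hdenR]; exact one_le_pow₀ (by norm_num))
  have hsI : partialSum 2 N ∈ Set.Icc (0 : ℝ) 2 :=
    ⟨(partialSum_two_pos N).le,
     ((partialSum_two_lt_liouvilleNumber N).trans liouvilleNumber_two_lt).le.trans (by norm_num)⟩
  have hlI : liouvilleNumber 2 ∈ Set.Icc (0 : ℝ) 2 :=
    ⟨liouvilleNumber_two_pos.le, liouvilleNumber_two_lt.le.trans (by norm_num)⟩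
  have hup : |bev P (partialSum 2 N) t| ≤ C₆ * |partialSum 2 N - liouvilleNumber 2| + C₂ * |(t : ℝ) - ρ| := by
    have e : bev P (partialSum 2 N) t =
        (bev P (partialSum 2 N) t - bev P (liouvilleNumber 2) t) +
          (bev P (liouvilleNumber 2) t - bev P (liouvilleNumber 2) ρ) := by rw [h0]; ring
    rw [e]
    exact (abs_add_le _ _).trans (add_le_add (hLx _ _ _ hsI hlI htρ) (hLy _ htρ))
  have hs_lt : |partialSum 2 N - liouvilleNumber 2| < 2 / 2 ^ (N + 1)! := by
    rw [abs_sub_comm]; exact abs_liouvilleNumber_two_sub_partialSum N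
  have ht_lt : |(t : ℝ) - ρ| < 1 / (2 : ℝ) ^ (E * (a + d + V + 2)) := by
    rw [abs_sub_comm, pow_mul, ← hdenR]; exact hlt
  have hup' : |bev P (partialSum 2 N) t| <
      C₆ * (2 / (2 : ℝ) ^ (N + 1)!) + C₂ * (1 / (2 : ℝ) ^ (E * (a + d + V + 2))) :=
    hup.trans_lt (add_lt_add (mul_lt_mul_of_pos_left hs_lt hC₆) (mul_lt_mul_of_pos_left ht_lt hC₂))
  have hfin := collar_final_ineq (a := a) (d := d) (V := V) (N := N) (h := h) hC₂ hC₆ hK₀ (by omega) hN2 hhN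
  have hpos : (0 : ℝ) < (2 : ℝ) ^ (E * d) := by positivity
  have := mul_lt_mul_of_pos_left hup' hpos
  rw [hE] at this hint
  linarith

/-- **(T3) `(ℓ₂, ρ)` is algebraically independent over `ℚ` for every `ρ ∈ DyadicCollarLiouville` —
HYPOTHESIS-FREE** (tree `algebraicIndependent_of_no_relation`, DL05, BY NAME). -/
theorem algebraicIndependent_ell2_of_collar {ρ : ℝ} (hρ : DyadicCollarLiouville ρ) :
    AlgebraicIndependent ℚ ![((liouvilleNumber 2 : ℝ) : ℂ), (ρ : ℂ)] :=
  algebraicIndependent_of_no_relation fun P hP => bev_ne_zero_of_collar hρ P hP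

/-- The (b)-statement of the K-line ON THE COLLAR, for EVERY `m ≥ 1` (indeed with no Skel hypothesis at all —
this is (T3) restricted; stated for the record: class-level (b) at fixed `m` is FALSE on `Skel₍₁₎` by the
tree's `not_skelFixOne_algebraicIndependent`, and its witness `u⋆` is not collar, `not_dyadicCollarLiouville_uStar`). -/
theorem statement_b_on_collar (m : ℕ) {ρ : ℝ} (_hS : SkelLiouvilleFix m ρ) (hρ : DyadicCollarLiouville ρ) :
    AlgebraicIndependent ℚ ![((liouvilleNumber 2 : ℝ) : ℂ), (ρ : ℂ)] :=
  algebraicIndependent_ell2_of_collar hρ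

/-- the same, CLAIM-literal form («∀ m ≥ 1, ∀ ρ, ρ ∈ Skel₍m₎ → ρ ∈ Collar → ℓ₂ ⫫ ρ»; = T3 restricted to `Skel₍m₎ ∩ Collar` —
the Skel hypothesis is not used: the collar datum alone decides). -/
theorem statement_b_on_collar_ge_one :
    ∀ m : ℕ, 1 ≤ m → ∀ ρ : ℝ, SkelLiouvilleFix m ρ → DyadicCollarLiouville ρ →
      AlgebraicIndependent ℚ ![((liouvilleNumber 2 : ℝ) : ℂ), (ρ : ℂ)] :=
  fun m _ _ hS hρ => statement_b_on_collar m hS hρ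

open Summit.Schanuel.Schanuel.Theorems.RootDecomp1KSkelCell (uStar not_algebraicIndependent_ell2_uStar
  skelLiouvilleFix_one_uStar) in
/-- `u⋆ = 1/(ℓ₂ − 1) ∈ Skel₍₁₎` (tree) is NOT collar: its skeleton-located approximants ARE level points. -/
theorem not_dyadicCollarLiouville_uStar : ¬ DyadicCollarLiouville uStar :=
  fun h => not_algebraicIndependent_ell2_uStar (algebraicIndependent_ell2_of_collar h)

/-- **(T4a) THE PAIR CELL `(ℓ₂, ρ)`, `ρ` collar: `SB 2` — HYPOTHESIS-FREE** (tree `sb_of_algebraicIndependent`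
BY NAME). -/
theorem sb_collarPair {ρ : ℝ} (hρ : DyadicCollarLiouville ρ) :
    SB 2 ![((liouvilleNumber 2 : ℝ) : ℂ), (ρ : ℂ)] := by
  refine sb_of_algebraicIndependent (algebraicIndependent_ell2_of_collar hρ) (by simp) ?_
  intro i
  exact mem_adjoin_SFset_I' (Or.inl (Set.mem_range_self i))

/-- **(T4b) ITEM 31077 ON THE COLLAR PAIR** — the binders of
`Summit.Schanuel.Schanuel.Theses.RootDecomp1K.CoordLiouvilleSchanuel` VERBATIM, with ONE line inserted after
`LinearIndependent ℚ z`: the cell `Set.range z = Set.range ![ℓ₂, ρ]`, `ρ ∈ DyadicCollarLiouville`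
(`ℓ₂` is the Liouville coordinate of the scope).  HYPOTHESIS-FREE for the WHOLE class. -/
theorem coordLiouvilleSchanuel_collarPair {ρ : ℝ} (hρ : DyadicCollarLiouville ρ) :
    ∀ (n : ℕ) (z : Fin n → ℂ), LinearIndependent ℚ z →
      Set.range z = Set.range ![((liouvilleNumber 2 : ℝ) : ℂ), (ρ : ℂ)] →
      (∃ w ∈ Submodule.span ℚ (Set.range z), Liouville w.re ∨ Liouville w.im) →
      (n : Cardinal) ≤ Algebra.trdeg ℚ
        ↥(IntermediateField.adjoin ℚ (Set.range z ∪ Set.range (Complex.exp ∘ z))) := by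
  intro n z hz hrange _
  exact sb_of_range_eq' hz.injective hrange (sb_collarPair hρ)

end Engine

end Summit.Schanuel.Schanuel.Theorems.RootDecomp1KCollarCell

end
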